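/-
Copyright: the b2b-balaban T⁴-continuum CRUX team, row NE7b OWNER lineage `t4-ne7b-p1` (gen 122). Project licence.
-/
import Summits.QuantumFields.BalabanUV.T4Continuum.Spine.NE7b.SupTorusSupNormBound
import Literature.MathematicalPhysics.QuantumFieldTheory.Balaban1983to89.Beta.PoissonInterior

/-!
# THE BLOCK-`ℓ¹` LETTER OF `H_V⁻¹` FOR EVERY SOURCE ON THE ROAD'S CLASS `V ≥ −λ`, AND THE TWO INPUTS OF INTERIOR REGULARITY ON THE TORUS:
# `Σ_{B_y}|H_V⁻¹f| ≤ (n+1)^d·m_κ⁻¹e^{2dκ}K_κ·‖f‖_∞` over EVERY block (duality against SIGN sources + (138)), the lattice Laplacian of the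
# periodic lift `u∘σ` IS the displayed second-difference sum, and a cube of radius `3m ≤ n+1` meets `3^d` lattice blocks — so that the
# tree's `Beta.PoissonInterior.interior_estimate` can be read on the fine torus (row NE7b, node U5c; (133)∕(138)∕(148) BY NAME; [folklore])

Cell `pub-balaban`, sub-cell `t4`, spine estimate NE7b (`T4WeightBudget.RelWeightBound`; the cell's OWN estimate — NOT PRINTED in
[Bałaban 1983–89], NOT PROVED).  Crux-route work under `Spine/NE7b/` by the row OWNER (`t4-ne7b-p1` gen 122, file (151)) under FREEZE
(0)'s crux-prover clause; NOTHING of Bałaban's is named as a Lean object, valued or asserted; no `T4Continuum/Support` leaf typed; no `def`,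
no notation (the action DISPLAYED exactly as in (133)–(150); the periodic lift is the lambda `fun p => u (σ p)`); zero `sorry`.
Imports (BY NAME): the OWNER's (148) `…SupTorusSupNormBound` (`action_surjective`; through it (138) `blockSq_le_of_block_source`, (133)
`action_form_symm`, `sum_indicator_mul`, (132) `isPseudoDist_torus`, `torus_sum_exp_le`, (89) TDF∕TDFC∕PTC∕(55) torus dictionary
`sum_fine_eq_sum_blocks`, `comp_siteOf_periodic`, `exists_windowMap_siteOf`, `sum_B_translate`, [B6] `B_disjoint`), and the β-team's
`Beta.PoissonInterior` (only its `cube`∕`mem_cube`; its `interior_estimate` is consumed by the next file).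

WHY (located).  § [NE7bP1-G121-HANDOFF] NEXT (3)(a): «the POINTWISE theory on the ROAD's class `V ≥ −λ` of either sign: the maximum
principle is unavailable; needs … a local mean-value inequality … → pointwise from block-`ℓ²`».  The mean-value inequality is IN THE TREE
(`PoissonInterior.interior_estimate`, harmonic side in `ℓ¹` of a cube of `ℤ^d`); to read it on the fine torus one needs exactly: (§1) the
`ℤ^d`-Laplacian of the periodic lift of a torus field in the road's displayed letters; (§2) the `ℓ¹` size of `u = H⁻¹f` on EVERY block for
EVERY bounded source — (148) `blockMean_le_sup` gives block MEANS by duality with the columns `ψ_y = H⁻¹𝟙_{B_y}`; the same duality against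
the SIGN source `g = 𝟙_{B_y}·sgn u` gives `Σ_{B_y}|u| = ⟨g,u⟩ = ⟨H⁻¹g, f⟩ ≤ ‖H⁻¹g‖_{ℓ¹}‖f‖_∞`, and `H⁻¹g` is block-`ℓ²` local by (138)
(`Σg² ≤ (n+1)^d`), so `‖H⁻¹g‖_{ℓ¹} ≤ (n+1)^d·m_κ⁻¹e^{2dκ}K_κ` — one block volume, MESH-FREE per site; (§3) the `ℓ¹` norm over a cube of
radius `3m ≤ n+1` from block sums (the cube lies in the `3^d` blocks around the block of its centre).

WHAT IS PROVED ([folklore]; fine torus `Site d ((n+1)s)`, coarse `Site d s`, `[NeZero s]`; the action DISPLAYED; `σ = siteOf`, `bt x =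
σ_s(blk n (wm x))`; `m_κ = min(2,a) − λ − 2dκ² − a(e^{2dκ} − 1)`; `K_κ = (2∕(1 − e^{−κ}))^d`):
* §1 `lap_lift` (`Δ_{ℤ^d}(u∘σ)(q) = −Σ_μ(2u(σq) − u(σq + ê_μ) − u(σq − ê_μ))`, every period).
* §2 `floor_pos_of_rate`; **`blockL1_le_sup`** (`a ≥ 0`, `V ≥ −λ`, `m_κ > 0`, `|f| ≤ M`, `Hu = f` ⟹ `Σ_z |u(σ(chart n (wm y) z))| ≤
  (n+1)^d·m_κ⁻¹e^{2dκ}K_κ·M` for EVERY coarse `y` — no support condition); `blockL1_le_sup_lattice` (the same over `B n b` for EVERY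
  lattice block label `b ∈ ℤ^d`).
* §3 `blk_near_of_mem_cube`, `cube_subset_blocks`, `card_nearBlocks`, `sum_cube_le` (`3m ≤ n+1` ⟹ `cube q (3m)` lies in the `3^d`
  lattice blocks `b` with `‖b − blk n q‖_∞ ≤ 1`; a nonnegative `F` with block sums `≤ K` has `Σ_{cube q (3m)} F ≤ 3^d·K`).
* §4 toy.

HONEST (what this is NOT).  Letters only — the sup-norm bound and the pointwise decay on the road's class are the next files; constants far
from sharp; cubic periods; scalar skeleton ((A3), NC-NE7b-α UNRULED); nothing of the covariant propagators of [B4]–[B6]; nothing of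
Bałaban's.  BY-NAME EFFECT ON THE WALL: NONE.  NE7b NOT PRINTED ∕ NOT PROVED; spine PROVED 0∕9; rung (B)+1 on a FINITE torus — NOT infinite
volume, NOT the mass gap, NOT Clay.  HONEST DEPENDENCY: continuum YM on T⁴ ⇐ BetaPertH ∧ nine spine estimates (0∕9 proved); BetaPertH ⇐
(D1) ∧ (D4) ∧ CAP+tail; G-an2-4 gates asym, D1 and NE2∕3∕4.
-/

set_option autoImplicit false

noncomputable section

namespace Summit.QuantumFields.BalabanUV.T4Continuum.NE7b.SupTorusBlockL1Letter

open Real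
open Literature.MathematicalPhysics.QuantumFieldTheory.Balaban1983to89
open Literature.Probability.LatticeModels (latticeLaplacianZd)
open B6QGQLower276 (X e blk B side chart mem_B sum_B sum_B_const card_cube blk_chart B_disjoint side_facts)
open Beta (Site siteOf windowMap siteOf_windowMap siteOf_add siteOf_sub)
open Beta.PoissonInterior (cube mem_cube)
open SupTorusDirichletForm (sum_fine_eq_sum_blocks)
open SupTorusDirichletFormCoercive (comp_siteOf_periodic)
open PeriodicSupTorusCarrier (exists_windowMap_siteOf)
open OneShotChartTorusRowsZd (sum_B_translate)
open SupTorusBlockDistance (isPseudoDist_torus torus_sum_exp_le)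
open SupTorusActionForm (action_form_symm sum_indicator_mul)
open SupTorusPropagatorLocality (blockSq_le_of_block_source)
open SupTorusSupNormBound (action_surjective)

variable {d : ℕ}

/-! ## §1. The periodic lift of a torus field and the lattice Laplacian -/

/-- **THE LATTICE LAPLACIAN OF THE PERIODIC LIFT**: for `U = u∘σ` (`σ = siteOf`, any period `N`),
`Δ_{ℤ^d}U(q) = −Σ_μ(2u(σq) − u(σq + ê_μ) − u(σq − ê_μ))`, `ê_μ = σ(e μ)` — the displayed second-difference sum of the road's action, read on
`ℤ^d`. [folklore] -/
theorem lap_lift (N : ℕ) (u : Site d N → ℝ) (q : X d) :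
    latticeLaplacianZd (fun p : X d => u (siteOf d N p)) q
      = -(∑ μ, (2 * u (siteOf d N q) - u (siteOf d N q + siteOf d N (e μ)) - u (siteOf d N q - siteOf d N (e μ)))) := by
  rw [Literature.Probability.LatticeModels.latticeLaplacianZd_def]
  simp only [siteOf_add, siteOf_sub, e]
  have h : ∀ μ : Fin d, 2 * u (siteOf d N q) - u (siteOf d N q + siteOf d N (Pi.single μ 1)) - u (siteOf d N q - siteOf d N (Pi.single μ 1))
      = 2 * u (siteOf d N q) - (u (siteOf d N q + siteOf d N (Pi.single μ 1)) + u (siteOf d N q - siteOf d N (Pi.single μ 1))) :=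
    fun μ => by ring
  rw [Finset.sum_congr rfl fun μ _ => h μ, Finset.sum_sub_distrib, Finset.sum_const, Finset.card_univ, Fintype.card_fin, nsmul_eq_mul]
  ring

/-! ## §2. The block-`ℓ¹` letter of `H⁻¹` for EVERY source: duality against sign sources -/

/-- From `m_κ > 0` back to `min(2,a) − λ > 0` (the two subtracted terms are nonnegative). [folklore] -/
theorem floor_pos_of_rate {a : ℝ} (ha : 0 ≤ a) {lam κ : ℝ} (hκ0 : 0 < κ)
    (hm : 0 < min 2 a - lam - 2 * d * κ ^ 2 - a * (exp (2 * d * κ) - 1)) : 0 < min 2 a - lam := by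
  have hd : (0 : ℝ) ≤ d := Nat.cast_nonneg d
  have h1 : 0 ≤ 2 * (d : ℝ) * κ ^ 2 := by positivity
  have h2 : 0 ≤ a * (exp (2 * d * κ) - 1) :=
    mul_nonneg ha (sub_nonneg.2 (one_le_exp (by positivity)))
  linarith

section Duality

variable (n : ℕ) (a : ℝ) (s : ℕ) [NeZero s] (ha : 0 ≤ a) {lam κ : ℝ} (hκ0 : 0 < κ) (hκ1 : κ ≤ 1)
  (hm : 0 < min 2 a - lam - 2 * d * κ ^ 2 - a * (exp (2 * d * κ) - 1))
  (V : Site d ((n + 1) * s) → ℝ) (hV : ∀ x, -lam ≤ V x)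
  (u f : Site d ((n + 1) * s) → ℝ)
  (hu : ∀ x, ((n : ℝ) + 1) ^ 2 * ∑ μ, (2 * u x - u (x + siteOf d ((n + 1) * s) (e μ)) - u (x - siteOf d ((n + 1) * s) (e μ)))
      + a / ((n : ℝ) + 1) ^ d * ∑ q ∈ B n (blk n (windowMap d ((n + 1) * s) x)), u (siteOf d ((n + 1) * s) q) + V x * u x = f x)

include ha hκ0 hκ1 hm hV hu in
/-- **THE BLOCK-`ℓ¹` LETTER OF `H⁻¹` FOR EVERY SOURCE**: `|f| ≤ M`, `Hu = f` (displayed action, `V ≥ −λ`, `m_κ > 0`) ⟹ over EVERY block `y`,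
`Σ_z |u(σ(chart n (wm y) z))| ≤ (n+1)^d·m_κ⁻¹e^{2dκ}K_κ·M`, `K_κ = (2∕(1 − e^{−κ}))^d` — no support condition on `f`.  Duality ((133)
`action_form_symm`) against the SIGN SOURCE `g = 𝟙_{B_y}·sgn u`: `Σ_{B_y}|u| = ⟨g, u⟩ = ⟨H⁻¹g, f⟩ ≤ ‖H⁻¹g‖_{ℓ¹}·M`, and `H⁻¹g` is block-`ℓ²`
local by (138) `blockSq_le_of_block_source` (`Σ g² ≤ (n+1)^d`), so `‖H⁻¹g‖_{ℓ¹} ≤ Σ_{y′}(n+1)^{d∕2}‖H⁻¹g‖_{ℓ²(B_{y′})} ≤ (n+1)^d·m_κ⁻¹e^{2dκ}K_κ`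
((132) `torus_sum_exp_le`) — one block volume exactly, MESH-FREE per site. [folklore] -/
theorem blockL1_le_sup {M : ℝ} (hfM : ∀ x, |f x| ≤ M) (y : Site d s) :
    ∑ z : Fin d → Fin (n + 1), |u (siteOf d ((n + 1) * s) (chart n (windowMap d s y) z))|
      ≤ ((n : ℝ) + 1) ^ d * ((min 2 a - lam - 2 * d * κ ^ 2 - a * (exp (2 * d * κ) - 1))⁻¹ * exp (2 * d * κ)
        * (2 * (1 - exp (-κ))⁻¹) ^ d) * M := by
  classical
  set m := min 2 a - lam - 2 * d * κ ^ 2 - a * (exp (2 * d * κ) - 1) with hm_def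
  have hvol : (0 : ℝ) < ((n : ℝ) + 1) ^ d := by positivity
  have hminv : 0 ≤ m⁻¹ := inv_nonneg.2 hm.le
  have hm0 : 0 < min 2 a - lam := floor_pos_of_rate (d := d) ha hκ0 hm
  -- the sign source supported in the block `y`
  set g : Site d ((n + 1) * s) → ℝ := fun x =>
    (if siteOf d s (blk n (windowMap d ((n + 1) * s) x)) = y then (1 : ℝ) else 0) * (if 0 ≤ u x then 1 else -1) with hg
  have hgsupp : ∀ x, siteOf d s (blk n (windowMap d ((n + 1) * s) x)) ≠ y → g x = 0 := fun x hx => by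
    simp only [hg, if_neg hx, zero_mul]
  have hg1 : ∀ x, |g x| ≤ 1 := fun x => by
    simp only [hg]; split_ifs <;> simp
  have hg2 : ∑ x, g x ^ 2 ≤ ((n : ℝ) + 1) ^ d := by
    have e1 : ∀ x, g x ^ 2 = (if siteOf d s (blk n (windowMap d ((n + 1) * s) x)) = y then (1 : ℝ) else 0) * 1 := fun x => by
      simp only [hg]; split_ifs <;> simp
    rw [Finset.sum_congr rfl fun x _ => e1 x, sum_indicator_mul n s y (fun _ => (1 : ℝ)), Finset.sum_const, Finset.card_univ,
      nsmul_eq_mul, mul_one, card_cube]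
  obtain ⟨v, hv⟩ := action_surjective n a s ha hm0 V hV g
  -- duality: `⟨g, u⟩ = ⟨H⁻¹g, f⟩`
  have hdual : ∑ x, u x * g x = ∑ x, v x * f x := by
    have h := action_form_symm n a s V u v
    simp only [hu, hv] at h
    rw [← h]
  -- the left side is the block `ℓ¹` norm
  have hL : ∑ x, u x * g x = ∑ z : Fin d → Fin (n + 1), |u (siteOf d ((n + 1) * s) (chart n (windowMap d s y) z))| := by
    have e1 : ∀ x, u x * g x = (if siteOf d s (blk n (windowMap d ((n + 1) * s) x)) = y then (1 : ℝ) else 0) * |u x| := fun x => by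
      simp only [hg]
      split_ifs with h1 h2
      · rw [abs_of_nonneg h2]; ring
      · rw [abs_of_neg (not_le.1 h2)]; ring
      · ring
      · ring
    rw [Finset.sum_congr rfl fun x _ => e1 x, sum_indicator_mul n s y (fun x => |u x|)]
  -- the block `ℓ²` letter of `v = H⁻¹g` from (138), read blockwise in `ℓ¹` by Cauchy–Schwarz
  have hblock : ∀ y' : Site d s, ∑ p ∈ B n (windowMap d s y'), |v (siteOf d ((n + 1) * s) p)|
      ≤ ((n : ℝ) + 1) ^ d * (m⁻¹ * exp (2 * d * κ)) * exp (-(κ * ∑ i, (((y' i - y i).valMinAbs.natAbs : ℕ) : ℝ))) := by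
    intro y'
    rw [sum_B]
    have hCS := sq_sum_le_card_mul_sum_sq (s := (Finset.univ : Finset (Fin d → Fin (n + 1))))
      (f := fun z => |v (siteOf d ((n + 1) * s) (chart n (windowMap d s y') z))|)
    rw [Finset.card_univ, card_cube] at hCS
    simp only [sq_abs] at hCS
    have hcol := blockSq_le_of_block_source n a s ha hκ0.le hκ1 hm V hV y v g hgsupp hv y'
    have h4 : exp (4 * d * κ) = exp (2 * d * κ) ^ 2 := by rw [sq, ← exp_add]; ring_nf
    have h5 : exp (-(2 * κ * ∑ i, (((y' i - y i).valMinAbs.natAbs : ℕ) : ℝ)))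
        = exp (-(κ * ∑ i, (((y' i - y i).valMinAbs.natAbs : ℕ) : ℝ))) ^ 2 := by rw [sq, ← exp_add]; ring_nf
    have hR : 0 ≤ ((n : ℝ) + 1) ^ d * (m⁻¹ * exp (2 * d * κ)) * exp (-(κ * ∑ i, (((y' i - y i).valMinAbs.natAbs : ℕ) : ℝ))) := by
      positivity
    have hsq : (∑ z : Fin d → Fin (n + 1), |v (siteOf d ((n + 1) * s) (chart n (windowMap d s y') z))|) ^ 2
        ≤ (((n : ℝ) + 1) ^ d * (m⁻¹ * exp (2 * d * κ)) * exp (-(κ * ∑ i, (((y' i - y i).valMinAbs.natAbs : ℕ) : ℝ)))) ^ 2 := by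
      refine hCS.trans ?_
      calc ((n : ℝ) + 1) ^ d * ∑ z : Fin d → Fin (n + 1), v (siteOf d ((n + 1) * s) (chart n (windowMap d s y') z)) ^ 2
          ≤ ((n : ℝ) + 1) ^ d * ((m⁻¹) ^ 2 * exp (4 * d * κ)
              * exp (-(2 * κ * ∑ i, (((y' i - y i).valMinAbs.natAbs : ℕ) : ℝ))) * ∑ x, g x ^ 2) :=
            mul_le_mul_of_nonneg_left hcol hvol.le
        _ ≤ ((n : ℝ) + 1) ^ d * ((m⁻¹) ^ 2 * exp (4 * d * κ)
              * exp (-(2 * κ * ∑ i, (((y' i - y i).valMinAbs.natAbs : ℕ) : ℝ))) * ((n : ℝ) + 1) ^ d) :=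
            mul_le_mul_of_nonneg_left (mul_le_mul_of_nonneg_left hg2 (by positivity)) hvol.le
        _ = _ := by rw [h4, h5]; ring
    exact (abs_le_of_sq_le_sq' hsq hR).2
  have hsum : ∑ y' : Site d s, exp (-(κ * ∑ i, (((y' i - y i).valMinAbs.natAbs : ℕ) : ℝ))) ≤ (2 * (1 - exp (-κ))⁻¹) ^ d := by
    have h := torus_sum_exp_le (d := d) s hκ0 y
    refine le_trans (le_of_eq (Finset.sum_congr rfl fun y' _ => ?_)) h
    rw [(isPseudoDist_torus (d := d) s).symm y' y]
  have hl1 : ∑ x, |v x| ≤ ((n : ℝ) + 1) ^ d * (m⁻¹ * exp (2 * d * κ)) * (2 * (1 - exp (-κ))⁻¹) ^ d := by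
    rw [sum_fine_eq_sum_blocks n s (fun x => |v x|)]
    calc ∑ y' : Site d s, ∑ p ∈ B n (windowMap d s y'), |v (siteOf d ((n + 1) * s) p)|
        ≤ ∑ y' : Site d s, ((n : ℝ) + 1) ^ d * (m⁻¹ * exp (2 * d * κ)) * exp (-(κ * ∑ i, (((y' i - y i).valMinAbs.natAbs : ℕ) : ℝ))) :=
          Finset.sum_le_sum fun y' _ => hblock y'
      _ = ((n : ℝ) + 1) ^ d * (m⁻¹ * exp (2 * d * κ)) * ∑ y' : Site d s, exp (-(κ * ∑ i, (((y' i - y i).valMinAbs.natAbs : ℕ) : ℝ))) := by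
          rw [Finset.mul_sum]
      _ ≤ _ := mul_le_mul_of_nonneg_left hsum (by positivity)
  have hM : 0 ≤ M := (abs_nonneg _).trans (hfM (siteOf d ((n + 1) * s) (chart n (windowMap d s y) 0)))
  calc ∑ z : Fin d → Fin (n + 1), |u (siteOf d ((n + 1) * s) (chart n (windowMap d s y) z))|
      = ∑ x, v x * f x := by rw [← hL, hdual]
    _ ≤ ∑ x, |v x * f x| := Finset.sum_le_sum fun x _ => le_abs_self _
    _ ≤ ∑ x, |v x| * M := Finset.sum_le_sum fun x _ => by rw [abs_mul]; exact mul_le_mul_of_nonneg_left (hfM x) (abs_nonneg _)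
    _ = (∑ x, |v x|) * M := (Finset.sum_mul _ _ _).symm
    _ ≤ (((n : ℝ) + 1) ^ d * (m⁻¹ * exp (2 * d * κ)) * (2 * (1 - exp (-κ))⁻¹) ^ d) * M := mul_le_mul_of_nonneg_right hl1 hM
    _ = _ := by ring

include ha hκ0 hκ1 hm hV hu in
/-- **THE BLOCK-`ℓ¹` LETTER OVER EVERY LATTICE BLOCK**: for EVERY block label `b ∈ ℤ^d` (not only window representatives),
`Σ_{q ∈ B n b} |u(σ q)| ≤ (n+1)^d·m_κ⁻¹e^{2dκ}K_κ·M` — the window representative of `σ_s b` is a period translate of `b` (PTC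
`exists_windowMap_siteOf`), block sums transport ((55) `sum_B_translate`) and `u∘σ` is periodic (TDFC `comp_siteOf_periodic`). [folklore] -/
theorem blockL1_le_sup_lattice {M : ℝ} (hfM : ∀ x, |f x| ≤ M) (b : X d) :
    ∑ q ∈ B n b, |u (siteOf d ((n + 1) * s) q)|
      ≤ ((n : ℝ) + 1) ^ d * ((min 2 a - lam - 2 * d * κ ^ 2 - a * (exp (2 * d * κ) - 1))⁻¹ * exp (2 * d * κ)
        * (2 * (1 - exp (-κ))⁻¹) ^ d) * M := by
  have h := blockL1_le_sup n a s ha hκ0 hκ1 hm V hV u f hu hfM (siteOf d s b)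
  obtain ⟨t, ht⟩ := exists_windowMap_siteOf s b
  rw [← sum_B (windowMap d s (siteOf d s b)) (fun q => |u (siteOf d ((n + 1) * s) q)|), ht, sum_B_translate] at h
  simpa only [comp_siteOf_periodic] using h

end Duality

/-! ## §3. A cube of radius `3m ≤ n+1` lies in `3^d` lattice blocks -/

section Cubes

/-- If `q′ ∈ cube q (3m)` and `3m ≤ n+1` then every block coordinate of `q′` is within `1` of that of `q`. [folklore] -/
theorem blk_near_of_mem_cube {n m : ℕ} (h3m : 3 * m ≤ n + 1) {q q' : X d} (hq' : q' ∈ cube q (3 * m)) (i : Fin d) :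
    blk n q i - 1 ≤ blk n q' i ∧ blk n q' i ≤ blk n q i + 1 := by
  have hs : (0 : ℤ) < side n := (side_facts n).1
  have hside : side n = (n : ℤ) + 1 := rfl
  have hi := (mem_cube.1 hq') i
  have h3 : ((3 * m : ℕ) : ℤ) ≤ side n := by rw [hside]; exact_mod_cast h3m
  obtain ⟨hlo, hhi⟩ := abs_le.1 hi
  have h1 : q' i ≤ q i + 1 * side n := by linarith
  have h2 : q i ≤ q' i + 1 * side n := by linarith
  have e1 : (q i + 1 * side n) / side n = q i / side n + 1 := Int.add_mul_ediv_right _ _ hs.ne'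
  have e2 : (q' i + 1 * side n) / side n = q' i / side n + 1 := Int.add_mul_ediv_right _ _ hs.ne'
  have k1 := Int.ediv_le_ediv hs h1
  have k2 := Int.ediv_le_ediv hs h2
  rw [e1] at k1
  rw [e2] at k2
  show q i / side n - 1 ≤ q' i / side n ∧ q' i / side n ≤ q i / side n + 1
  constructor <;> linarith

/-- **THE CUBE IS COVERED BY THE NEIGHBOURING BLOCKS**: `3m ≤ n+1` ⟹ `cube q (3m) ⊆ ⋃_{‖b − blk n q‖_∞ ≤ 1} B n b`. [folklore] -/
theorem cube_subset_blocks {n m : ℕ} (h3m : 3 * m ≤ n + 1) (q : X d) :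
    cube q (3 * m) ⊆ (Fintype.piFinset fun i => Finset.Icc (blk n q i - 1) (blk n q i + 1)).biUnion (B n) := by
  classical
  intro q' hq'
  rw [Finset.mem_biUnion]
  refine ⟨blk n q', ?_, mem_B.2 rfl⟩
  rw [Fintype.mem_piFinset]
  intro i
  rw [Finset.mem_Icc]
  exact blk_near_of_mem_cube h3m hq' i

/-- There are `3^d` neighbouring blocks. [folklore] -/
theorem card_nearBlocks (n : ℕ) (q : X d) :
    (((Fintype.piFinset fun i => Finset.Icc (blk n q i - 1) (blk n q i + 1)).card : ℕ) : ℝ) = 3 ^ d := by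
  rw [Fintype.card_piFinset]
  have h : ∀ i : Fin d, (Finset.Icc (blk n q i - 1) (blk n q i + 1)).card = 3 := fun i => by
    rw [Int.card_Icc]
    have : blk n q i + 1 + 1 - (blk n q i - 1) = 3 := by ring
    rw [this]; rfl
  rw [Finset.prod_congr rfl fun i _ => h i, Finset.prod_const, Finset.card_univ, Fintype.card_fin]
  push_cast
  rfl

/-- **`ℓ¹` ON A CUBE FROM BLOCK SUMS**: `3m ≤ n+1`, `F ≥ 0` with `Σ_{B n b} F ≤ K` for every `b` ⟹ `Σ_{cube q (3m)} F ≤ 3^d·K` (distinct blocks are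
disjoint, `B_disjoint`). [folklore] -/
theorem sum_cube_le {n m : ℕ} (h3m : 3 * m ≤ n + 1) (q : X d) {F : X d → ℝ} (hF : ∀ p, 0 ≤ F p) {K : ℝ}
    (hK : ∀ b : X d, ∑ p ∈ B n b, F p ≤ K) :
    ∑ p ∈ cube q (3 * m), F p ≤ 3 ^ d * K := by
  classical
  set S := (Fintype.piFinset fun i => Finset.Icc (blk n q i - 1) (blk n q i + 1)) with hS
  have hdisj : (S : Set (X d)).PairwiseDisjoint (B n) := fun b _ b' _ hne => B_disjoint hne
  calc ∑ p ∈ cube q (3 * m), F p ≤ ∑ p ∈ S.biUnion (B n), F p :=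
        Finset.sum_le_sum_of_subset_of_nonneg (cube_subset_blocks h3m q) fun p _ _ => hF p
    _ = ∑ b ∈ S, ∑ p ∈ B n b, F p := Finset.sum_biUnion hdisj
    _ ≤ ∑ b ∈ S, K := Finset.sum_le_sum fun b _ => hK b
    _ = 3 ^ d * K := by rw [Finset.sum_const, nsmul_eq_mul, card_nearBlocks]

end Cubes

/-! ## §4. Toy -/

/-- Toy (`d = 0`, `n = 0`): a cube of radius `0` meets `3^0 = 1` block; the covering lemma is inhabited. -/
example : ∑ _p ∈ cube (0 : X 0) (3 * 0), (1 : ℝ) ≤ 3 ^ 0 * 1 :=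
  sum_cube_le (n := 0) (m := 0) (by norm_num) (0 : X 0) (F := fun _ => (1 : ℝ)) (fun _ => zero_le_one)
    (fun b => by rw [sum_B_const, pow_zero, one_mul])

end Summit.QuantumFields.BalabanUV.T4Continuum.NE7b.SupTorusBlockL1Letter
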